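import Literature.NumberTheory.Automorphic.PlaneLatticesHermiteForm             -- ★ (L5-a): `IsUniformizingElement`, `𝒪[F]`, 2×2 algebra idiom
import Literature.NumberTheory.Automorphic.UnitaryGroupFormTransport            -- ★ `formCongr`, `unitaryGroupOfForm`
import Literature.NumberTheory.LocalFields.RamifiedQuadraticNormCriterion      -- ★ B-p10 (g26) R-3: `RamifiedQuadraticNorm.exists_mul_map_eq_or_eq_mul` (σ-fixed units = norms ⊔ η·norms)
import HarnessLib

/-!
# [Rogawski1990 §4.9; LabesseLanglands1979 §2 pp. 8–9] road «R1-ram» (tamely RAMIFIED place), brick R-3 (LEMMA U′, frame form): the local class of an elliptic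
# regular element of `U(1,1)` at a fixed self-dual lattice is `c·(1 + ϖ^i·[[0, η^e],[0, 0]])` modulo `ϖ^m` — odd depth `i`, ONE BIT `e ∈ {0,1}`

Topic `NumberTheory/Automorphic`; namespace `Literature.NumberTheory.Automorphic`.  THEOREMS ONLY (no definition, no instance, no notation, no named fact, no `sorry`);
the RAMIFIED twin of ★ `UnitaryRankTwoTorusLocalClassFrame` (p843071): same 2×2 algebra over the valuation ring `𝒪 = 𝒪[F]`, now with an ANTI-FIXED uniformiser
`σϖ = −ϖ`, a RESIDUALLY TRIVIAL involution (`σx − x ∈ 𝔪`), `2 ∈ 𝒪ˣ`, and a σ-fixed non-square unit `η` (the frame of ★ B-p04 `RamifiedQuadraticOrder*` ∕ ★ B-p10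
`RamifiedQuadraticNormCriterion`).  Cell `pub/hodgecm-mathlib` (D-0151), crux H413 = `stmt-HodgeConjecture-24833`, line «N6nsGerm», residue `RankOneUnstableTransferNonsplitCMERamified`
of #159; LEAD F0P3a-plan (g10) T9-12; architect A-p16 (g27) RULING A-14 (c) (road of record = F0P3-p02 (g12) MEMO-R1ram e916cca5 §4, R-3 «window classes ∕ LEMMA U′»);
design + numerical certificate B-p12 (g29) census 758afe5c ∕ table 68cf7048.  HONEST LABEL: HC_CM is proved only modulo the printed citations (the 2 remaining named
inputs hLiu418, h413) until rung 0 closes; nothing printed is asserted here.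

MATHEMATICS.  As in the inert file: `k = [[a+py, −(a−c)y−py²],[p, c−py]]`, `p = ϖ^iα`, `α ∈ 𝒪ˣ`, `σp·ac = −p`, `(y+σy)p = c − a` (σ-generic).  RAMIFIED differences:
(1) the shear is `t := ρ∕2` (`ρ = ϖ^{N−m}u∕α`, `σρ = (−1)^{m−i}ρ`; `2 ∈ 𝒪ˣ`), making `[[y₁,1],[1,0]]` unitary; (2) `r := α∕c` has `σr − r = −(−1)^i α(a ± c)∕(ac)`, so the
residual triviality of `σ` FORCES `i` ODD (at a self-dual = edge-midpoint lattice), and then `σr − r ∈ ϖ^N𝒪`; (3) the σ-fixed correction `rt := (r + σr)∕2` is a unit which is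
a norm `λσλ` OR `η`·a norm (★ `exists_mul_map_eq_or_eq_mul`, index two) — the torus `diag(λ,(σλ)⁻¹)` then scales the corner to `η^e`, `e ∈ {0,1}`: the BIT of LEMMA U′
(= the sign `ω(x)` of MEMO-R1ram (S3); constant on shells and flipping with the angle class — the shell files ∕ table 68cf7048).
Head: **`exists_unitary_conj_eq_normalForm_of_eigenvector_ramified`** (eigenvector `(y,1)` form; the swap reduction of ★ `localClass_normalForm` applies verbatim).

## References
* [Rogawski1990] J. D. Rogawski, *Automorphic Representations of Unitary Groups in Three Variables*, Ann. of Math. Stud. 123 (1990): §4.9 Lemma 4.9.3 p. 56.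
* [LabesseLanglands1979] J.-P. Labesse, R. P. Langlands, *L-indistinguishability for SL(2)*, Canad. J. Math. 31 (1979): §2, Lemma 2.1, pp. 8–9 (ramified `δ_m = 2q^m`, (2.2)).
* [Jacobowitz1962] R. Jacobowitz, *Hermitian forms over local fields*, Amer. J. Math. 84 (1962): §8. [Serre1979] J.-P. Serre, *Local Fields* (1979): Ch. V §3.
-/

set_option autoImplicit false

noncomputable section

open scoped ValuativeRel Matrix MatrixGroups
open Matrix ValuativeRel

namespace Literature.NumberTheory.Automorphic

variable {F : Type*} [Field F] [ValuativeRel F]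

section Bookkeeping
variable (σ : F →+* F)

omit [ValuativeRel F] in
/-- `((!![x₀₀, x₀₁; x₁₀, x₁₁]).map σ)ᵀ = !![σx₀₀, σx₁₀; σx₀₁, σx₁₁]`. [cite: Jacobowitz1962, §4] -/
private theorem conjTranspose_fin_two (x₀₀ x₀₁ x₁₀ x₁₁ : F) :
    ((!![x₀₀, x₀₁; x₁₀, x₁₁] : Matrix (Fin 2) (Fin 2) F).map σ)ᵀ = !![σ x₀₀, σ x₁₀; σ x₀₁, σ x₁₁] := by
  ext i j; fin_cases i <;> fin_cases j <;> simp

omit [ValuativeRel F] in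
/-- `c • !![…] + d • !![…]` entrywise. [cite: Jacobowitz1962, §4] -/
private theorem smul_fin_two_add_smul_fin_two (c d : F) (x₀₀ x₀₁ x₁₀ x₁₁ y₀₀ y₀₁ y₁₀ y₁₁ : F) :
    c • (!![x₀₀, x₀₁; x₁₀, x₁₁] : Matrix (Fin 2) (Fin 2) F) + d • !![y₀₀, y₀₁; y₁₀, y₁₁] =
      !![c * x₀₀ + d * y₀₀, c * x₀₁ + d * y₀₁; c * x₁₀ + d * y₁₀, c * x₁₁ + d * y₁₁] := by
  ext i j; fin_cases i <;> fin_cases j <;> simp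

omit [ValuativeRel F] in
/-- The normal form, entrywise: `c • (1 + e • !![0, δ; 0, 0]) + f • R`. [cite: Jacobowitz1962, §4] -/
private theorem normalForm_add_eq (c e δ f : F) (r₀₀ r₀₁ r₁₀ r₁₁ : F) :
    c • ((1 : Matrix (Fin 2) (Fin 2) F) + e • !![0, δ; 0, 0]) + f • !![r₀₀, r₀₁; r₁₀, r₁₁] =
      !![c + f * r₀₀, c * e * δ + f * r₀₁; f * r₁₀, c + f * r₁₁] := by
  ext i j
  fin_cases i <;> fin_cases j <;> simp [Matrix.one_fin_two]
  ring

omit [Field F] [ValuativeRel F] in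
/-- Two `2×2` matrix literals agree if their entries do. [cite: Jacobowitz1962, §4] -/
private theorem fin_two_eq {x₀₀ x₀₁ x₁₀ x₁₁ y₀₀ y₀₁ y₁₀ y₁₁ : F} (h₀₀ : x₀₀ = y₀₀) (h₀₁ : x₀₁ = y₀₁) (h₁₀ : x₁₀ = y₁₀)
    (h₁₁ : x₁₁ = y₁₁) : (!![x₀₀, x₀₁; x₁₀, x₁₁] : Matrix (Fin 2) (Fin 2) F) = !![y₀₀, y₀₁; y₁₀, y₁₁] := by
  rw [h₀₀, h₀₁, h₁₀, h₁₁]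

/-- `x ∈ 𝒪`, `ϖ⁻¹x ∉ 𝒪` ⇒ `|x| = 1`. [cite: Serre1979, Ch. V §2] -/
private theorem valuation_eq_one_of_not_mem {ϖ : F} (hϖ : IsUniformizingElement ϖ) {x : F} (hx : x ∈ 𝒪[F]) (hx' : ϖ⁻¹ * x ∉ 𝒪[F]) :
    valuation F x = 1 := by
  refine le_antisymm ((Valuation.mem_integer_iff _ _).1 hx) (not_lt.1 fun hlt => hx' ?_)
  obtain ⟨y, hy, rfl⟩ := hϖ.exists_eq_mul hx hlt
  rwa [← mul_assoc, inv_mul_cancel₀ hϖ.ne_zero, one_mul]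

/-- `|x| = 1 ⇒ x⁻¹ ∈ 𝒪`. [cite: Serre1979, Ch. V §2] -/
private theorem inv_mem_of_valuation_eq_one {x : F} (hx : valuation F x = 1) : x⁻¹ ∈ 𝒪[F] :=
  (Valuation.mem_integer_iff _ _).2 (by rw [map_inv₀, hx, inv_one])

/-- `|x| = 1 ⇒ x ∈ 𝒪`. [cite: Serre1979, Ch. V §2] -/
private theorem mem_of_valuation_eq_one {x : F} (hx : valuation F x = 1) : x ∈ 𝒪[F] :=
  (Valuation.mem_integer_iff _ _).2 hx.le

/-- `|x| = 1 ⇒ x ≠ 0`. [cite: Serre1979, Ch. V §2] -/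
private theorem ne_zero_of_valuation_eq_one {x : F} (hx : valuation F x = 1) : x ≠ 0 := by
  intro h; rw [h, map_zero] at hx; exact zero_ne_one hx

end Bookkeeping

section Core

variable (σ : F →+* F) {ϖ : F} (hϖ : IsUniformizingElement ϖ) (hσϖ : σ ϖ = -ϖ)
  (σO : 𝒪[F] →+* 𝒪[F]) (hσO : ∀ x : 𝒪[F], ((σO x : 𝒪[F]) : F) = σ x) (hσσ : ∀ x, σO (σO x) = x)

include hσO in
/-- `σ(𝒪) ⊆ 𝒪`. [cite: Serre1979, Ch. V §2] -/
private theorem map_mem_integer {x : F} (hx : x ∈ 𝒪[F]) : σ x ∈ 𝒪[F] := by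
  rw [← hσO ⟨x, hx⟩]; exact SetLike.coe_mem _

include hσO hσσ in
/-- `σ(σ x) = x` on `𝒪`. [cite: Serre1979, Ch. V §2] -/
private theorem map_map_of_mem {x : F} (hx : x ∈ 𝒪[F]) : σ (σ x) = x := by
  have h1 : σ x = ((σO ⟨x, hx⟩ : 𝒪[F]) : F) := (hσO ⟨x, hx⟩).symm
  rw [h1, ← hσO, hσσ]

/-- `|x y| = 1`, `x, y ∈ 𝒪` ⇒ `|x| = 1`. [cite: Serre1979, Ch. V §2] -/
private theorem valuation_eq_one_of_mul_eq_one_left {x y : F} (hx : x ∈ 𝒪[F]) (hy : y ∈ 𝒪[F]) (h : valuation F (x * y) = 1) :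
    valuation F x = 1 := by
  refine le_antisymm ((Valuation.mem_integer_iff _ _).1 hx) ?_
  by_contra hlt
  have := mul_lt_one_of_lt_of_le (not_le.1 hlt) ((Valuation.mem_integer_iff _ _).1 hy)
  rw [← map_mul, h] at this; exact lt_irrefl _ this

include hϖ hσϖ hσO hσσ in
/-- **LEMMA U′ (tamely ramified, frame form).**  `k ∈ M₂(𝒪)` unitary for `J₀ = [[0,1],[1,0]]`, `(k − a)(k − c) = 0` with norm-one units `a, c`, `|a − c| = |ϖ^N|`,
a `c`-eigenvector `(y, 1)`, `y ∈ 𝒪`, exact depth `i` at `c`, `i < m ≤ N`; `σϖ = −ϖ`, `σ` residually trivial, `2 ∈ 𝒪ˣ`, `η` a σ-fixed unit with non-square residue.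
Then `i` is ODD and there are `κ ∈ M₂(𝒪)` unitary, a bit `e ≤ 1` and `R ∈ M₂(𝒪)` with `(J₀κᴴJ₀)·k·κ = c·(1 + ϖ^i·[[0, η^e],[0,0]]) + ϖ^m·R`.
[cite: LabesseLanglands1979, §2 Lemma 2.1 pp. 8–9] [cite: Rogawski1990, §4.9 Lemma 4.9.3 p. 56] [cite: Jacobowitz1962, §8] [cite: Serre1979, Ch. V §3] -/
theorem exists_unitary_conj_eq_normalForm_of_eigenvector_ramified
    [IsAdicComplete (IsLocalRing.maximalIdeal 𝒪[F]) 𝒪[F]] [Finite (IsLocalRing.ResidueField 𝒪[F])]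
    (h2 : IsUnit (2 : 𝒪[F])) (hres : ∀ x : 𝒪[F], σO x - x ∈ IsLocalRing.maximalIdeal 𝒪[F])
    {η : 𝒪[F]} (hηu : IsUnit η) (hση : σO η = η) (hη : ¬ IsSquare (IsLocalRing.residue 𝒪[F] η))
    {k : Matrix (Fin 2) (Fin 2) F} (hkO : ∀ r s, k r s ∈ 𝒪[F]) (hkU : (k.map σ)ᵀ * !![0, 1; 1, 0] * k = !![0, 1; 1, 0])
    {a c : F} (ha : σ a * a = 1) (hc : σ c * c = 1) (ha1 : valuation F a = 1) (hc1 : valuation F c = 1)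
    (hac : (k - a • 1) * (k - c • 1) = 0)
    {N : ℕ} (hN : valuation F (a - c) = valuation F (ϖ ^ N))
    {y : F} (hy : y ∈ 𝒪[F]) (hk0 : k 0 0 * y + k 0 1 = c * y) (hk1 : k 1 0 * y + k 1 1 = c)
    {i m : ℕ} (him : i < m) (hmN : m ≤ N)
    (hki : ∀ r s, ϖ ^ (-(i : ℤ)) * (k - c • 1) r s ∈ 𝒪[F]) (hki' : ¬ ∀ r s, ϖ ^ (-((i : ℤ) + 1)) * (k - c • 1) r s ∈ 𝒪[F]) :
    Odd i ∧ ∃ κ : Matrix (Fin 2) (Fin 2) F, (∀ r s, κ r s ∈ 𝒪[F]) ∧ (κ.map σ)ᵀ * !![0, 1; 1, 0] * κ = !![0, 1; 1, 0] ∧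
      ∃ e : ℕ, e ≤ 1 ∧ ∃ R : Matrix (Fin 2) (Fin 2) F, (∀ r s, R r s ∈ 𝒪[F]) ∧
        !![0, 1; 1, 0] * (κ.map σ)ᵀ * !![0, 1; 1, 0] * k * κ =
          c • (1 + ϖ ^ i • !![0, ((η : 𝒪[F]) : F) ^ e; 0, 0]) + ϖ ^ m • R := by
  have hϖ0 : ϖ ≠ 0 := hϖ.ne_zero; have hϖO : ϖ ∈ 𝒪[F] := hϖ.mem
  have hϖpow : ∀ n : ℕ, ϖ ^ n ∈ 𝒪[F] := fun n => (𝒪[F]).pow_mem hϖO n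
  have hσpow : ∀ n : ℕ, σ (ϖ ^ n) = (-1) ^ n * ϖ ^ n := fun n => by rw [map_pow, hσϖ, neg_eq_neg_one_mul, mul_pow]
  have hσmem : ∀ {x : F}, x ∈ 𝒪[F] → σ x ∈ 𝒪[F] := fun hx => map_mem_integer σ σO hσO hx
  have hσσ' : ∀ {x : F}, x ∈ 𝒪[F] → σ (σ x) = x := fun hx => map_map_of_mem σ σO hσO hσσ hx
  have ha0 : a ≠ 0 := ne_zero_of_valuation_eq_one ha1; have hc0 : c ≠ 0 := ne_zero_of_valuation_eq_one hc1
  have haO : a ∈ 𝒪[F] := mem_of_valuation_eq_one ha1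
  have hcO : c ∈ 𝒪[F] := mem_of_valuation_eq_one hc1
  have hσc : σ c = c⁻¹ := eq_inv_of_mul_eq_one_left hc
  have hσa : σ a = a⁻¹ := eq_inv_of_mul_eq_one_left ha
  set ϖ0 : F := ϖ ^ (-(i : ℤ)) with hϖ0def; set ϖ1 : F := ϖ ^ (-((i : ℤ) + 1)) with hϖ1def; clear_value ϖ0 ϖ1
  have hϖ0i : ϖ0 * ϖ ^ i = 1 := by rw [hϖ0def, ← zpow_natCast, ← zpow_add₀ hϖ0, neg_add_cancel, zpow_zero]
  have hϖ1i : ϖ1 * ϖ ^ (i + 1) = 1 := by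
    rw [hϖ1def, ← zpow_natCast, ← zpow_add₀ hϖ0, Nat.cast_add, Nat.cast_one, neg_add_cancel, zpow_zero]
  have hϖ10 : ϖ1 = ϖ⁻¹ * ϖ0 := by
    rw [hϖ1def, hϖ0def, ← _root_.zpow_neg_one, ← zpow_add₀ hϖ0]; congr 1; ring
  have hϖN1 : valuation F (ϖ ^ N) ≠ 0 := by rw [map_pow]; exact pow_ne_zero _ ((Valuation.ne_zero_iff _).2 hϖ0)
  set u : F := (a - c) * (ϖ ^ N)⁻¹ with hu; clear_value u
  have hu1 : valuation F u = 1 := by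
    rw [hu, map_mul, map_inv₀, hN, mul_inv_cancel₀ hϖN1]
  have huO : u ∈ 𝒪[F] := mem_of_valuation_eq_one hu1
  have hu0 : u ≠ 0 := ne_zero_of_valuation_eq_one hu1
  have hac' : a - c = ϖ ^ N * u := by rw [hu, mul_comm, mul_assoc, inv_mul_cancel₀ (pow_ne_zero _ hϖ0), mul_one]
  have hNi : i + 1 ≤ N := by omega
  have hz : ϖ1 * (a - c) = ϖ ^ (N - (i + 1)) * u := by
    rw [hac', show (ϖ ^ N : F) = ϖ ^ (i + 1) * ϖ ^ (N - (i + 1)) by rw [← pow_add, Nat.add_sub_cancel' hNi],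
      ← mul_assoc, ← mul_assoc, hϖ1i, one_mul]
  have hzO : ϖ1 * (a - c) ∈ 𝒪[F] := by rw [hz]; exact (𝒪[F]).mul_mem (hϖpow _) huO
  set p : F := k 1 0 with hp; clear_value p
  have hk11 : k 1 1 = c - p * y := by rw [← hk1]; ring
  have hk01 : k 0 1 = c * y - k 0 0 * y := by rw [← hk0]; ring
  have hpO : p ∈ 𝒪[F] := by rw [hp]; exact hkO 1 0
  have hsub : ∀ r s, (k - c • (1 : Matrix (Fin 2) (Fin 2) F)) r s = k r s - (if r = s then c else 0) := by
    intro r s; simp [Matrix.sub_apply, Matrix.smul_apply, Matrix.one_apply]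
  have hd00 : (k - c • (1 : Matrix (Fin 2) (Fin 2) F)) 0 0 = k 0 0 - c := by rw [hsub, if_pos rfl]
  have hd01 : (k - c • (1 : Matrix (Fin 2) (Fin 2) F)) 0 1 = k 0 1 := by rw [hsub, if_neg (by decide), sub_zero]
  have hd10 : (k - c • (1 : Matrix (Fin 2) (Fin 2) F)) 1 0 = p := by rw [hsub, if_neg (by decide), sub_zero, hp]
  have hd11 : (k - c • (1 : Matrix (Fin 2) (Fin 2) F)) 1 1 = k 1 1 - c := by rw [hsub, if_pos rfl]
  have h10 : p * (k 0 0 - a - p * y) = 0 := by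
    have h := congr_fun (congr_fun hac 1) 0
    simp [Matrix.mul_apply, Fin.sum_univ_two, Matrix.one_apply] at h
    rw [← hp, hk11] at h; linear_combination h
  have hp0 : p ≠ 0 := by
    intro hp0
    have h00 : (k 0 0 - a) * (k 0 0 - c) = 0 := by
      have h := congr_fun (congr_fun hac 0) 0
      simp [Matrix.mul_apply, Fin.sum_univ_two, Matrix.one_apply] at h
      rw [← hp, hp0] at h; linear_combination h
    apply hki'
    refine Fin.forall_fin_two.2 ⟨Fin.forall_fin_two.2 ⟨?_, ?_⟩, Fin.forall_fin_two.2 ⟨?_, ?_⟩⟩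
    · rw [hd00]
      rcases mul_eq_zero.1 h00 with h0 | h0
      · rw [sub_eq_zero.1 h0]; exact hzO
      · rw [h0, mul_zero]; exact (𝒪[F]).zero_mem
    · rw [hd01, hk01]
      rcases mul_eq_zero.1 h00 with h0 | h0
      · rw [sub_eq_zero.1 h0, show ϖ1 * (c * y - a * y) = -(ϖ1 * (a - c) * y) by ring]
        exact (𝒪[F]).neg_mem ((𝒪[F]).mul_mem hzO hy)
      · rw [sub_eq_zero.1 h0, sub_self, mul_zero]; exact (𝒪[F]).zero_mem
    · rw [hd10, hp0, mul_zero]; exact (𝒪[F]).zero_mem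
    · rw [hd11, hk11, hp0, zero_mul, sub_zero, sub_self, mul_zero]; exact (𝒪[F]).zero_mem
  have hk00 : k 0 0 = a + p * y := by
    have := (mul_eq_zero.1 h10).resolve_left hp0
    linear_combination this
  replace hk01 : k 0 1 = -((a - c) * y) - p * y ^ 2 := by rw [hk01, hk00]; ring
  have hkmat : k = !![a + p * y, -((a - c) * y) - p * y ^ 2; p, c - p * y] := by
    ext r s; fin_cases r <;> fin_cases s
    · simpa using hk00
    · simpa using hk01
    · simp [hp]
    · simpa using hk11
  set α : F := ϖ0 * p with hα; clear_value α
  have hαO : α ∈ 𝒪[F] := by have := hki 1 0; rwa [hd10, ← hα] at this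
  have hpα : p = ϖ ^ i * α := by rw [hα, ← mul_assoc, mul_comm (ϖ ^ i), hϖ0i, one_mul]
  have hα1 : valuation F α = 1 := by
    refine valuation_eq_one_of_not_mem hϖ hαO fun hα' => hki' ?_
    have hp1 : ϖ1 * p = ϖ⁻¹ * α := by rw [hϖ10, hα, mul_assoc]
    refine Fin.forall_fin_two.2 ⟨Fin.forall_fin_two.2 ⟨?_, ?_⟩, Fin.forall_fin_two.2 ⟨?_, ?_⟩⟩
    · rw [hd00, hk00, show ϖ1 * (a + p * y - c) = ϖ1 * (a - c) + ϖ1 * p * y by ring, hp1]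
      exact (𝒪[F]).add_mem hzO ((𝒪[F]).mul_mem hα' hy)
    · rw [hd01, hk01, show ϖ1 * (-((a - c) * y) - p * y ^ 2) = -(ϖ1 * (a - c) * y) - ϖ1 * p * (y * y) by ring, hp1]
      exact (𝒪[F]).sub_mem ((𝒪[F]).neg_mem ((𝒪[F]).mul_mem hzO hy)) ((𝒪[F]).mul_mem hα' ((𝒪[F]).mul_mem hy hy))
    · rw [hd10, hp1]; exact hα'
    · rw [hd11, hk11, show ϖ1 * (c - p * y - c) = -(ϖ1 * p * y) by ring, hp1]
      exact (𝒪[F]).neg_mem ((𝒪[F]).mul_mem hα' hy)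
  have hα0 : α ≠ 0 := ne_zero_of_valuation_eq_one hα1
  have hαinvO : α⁻¹ ∈ 𝒪[F] := inv_mem_of_valuation_eq_one hα1
  have hkH : (k.map σ)ᵀ = !![σ a + σ p * σ y, σ p; σ (-((a - c) * y) - p * y ^ 2), σ c - σ p * σ y] := by
    rw [hkmat, conjTranspose_fin_two]; simp only [map_add, map_mul, map_sub]
  have hU := hkU
  rw [hkH, hkmat, Matrix.mul_fin_two, Matrix.mul_fin_two] at hU
  have h00 := congr_fun (congr_fun hU 0) 0
  have h01 := congr_fun (congr_fun hU 0) 1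
  simp only [Matrix.of_apply, Matrix.cons_val', Matrix.cons_val_zero, Matrix.cons_val_one, Matrix.cons_val_fin_one,
    Matrix.empty_val'] at h00 h01
  have U1 : σ p * (a * c) + p = 0 := by linear_combination c * h00 - p * (h01 + y * h00)
  have U2 : (y + σ y) * p = c - a := by linear_combination (y + σ y) * U1 - a * (h01 + y * h00) + c * ha
  have hσp : σ p = -(p * (a * c)⁻¹) := by
    field_simp
    linear_combination U1
  have hm1 : ((-1 : F) ^ (-(i : ℤ))) = (-1) ^ i := by rw [_root_.zpow_neg, zpow_natCast, ← inv_pow, inv_neg, inv_one]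
  have hσϖ0 : σ ϖ0 = (-1) ^ i * ϖ0 := by rw [hϖ0def, map_zpow₀, hσϖ, neg_eq_neg_one_mul, mul_zpow, hm1]
  have hσα : σ α = -((-1) ^ i * (α * (a * c)⁻¹)) := by rw [hα, map_mul, hσϖ0, hσp]; ring
  have hsq : ∀ n : ℕ, (-1 : F) ^ n * (-1 : F) ^ n = 1 := fun n => by rw [← pow_add, ← two_mul, pow_mul, neg_one_sq, one_pow]
  obtain ⟨s, rfl⟩ := Nat.exists_eq_add_of_lt him
  obtain ⟨d, rfl⟩ := Nat.exists_eq_add_of_le hmN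
  have h21 : valuation F (2 : F) = 1 := by
    have h := (Valuation.integer.integers (valuation F)).isUnit_iff_valuation_eq_one.1 h2
    rwa [map_ofNat] at h
  have h20 : (2 : F) ≠ 0 := ne_zero_of_valuation_eq_one h21; have h2invO : (2 : F)⁻¹ ∈ 𝒪[F] := inv_mem_of_valuation_eq_one h21
  have hσ2 : σ (2 : F)⁻¹ = 2⁻¹ := by rw [map_inv₀, map_ofNat]
  have hη1 : valuation F ((η : 𝒪[F]) : F) = 1 := (Valuation.integer.integers (valuation F)).isUnit_iff_valuation_eq_one.1 hηu
  have hηO : ((η : 𝒪[F]) : F) ∈ 𝒪[F] := η.2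
  have hσσy : σ (σ y) = y := hσσ' hy
  set ρ : F := ϖ ^ d * u * α⁻¹ with hρ; clear_value ρ
  have hρO : ρ ∈ 𝒪[F] := by rw [hρ]; exact (𝒪[F]).mul_mem ((𝒪[F]).mul_mem (hϖpow d) huO) hαinvO
  have hρg : ρ * ϖ ^ (s + 1) = -(y + σ y) := by
    have h1 : (y + σ y) * (ϖ ^ i * α) = -(ϖ ^ (i + s + 1 + d) * u) := by rw [← hpα, U2]; linear_combination -hac'
    have h2' : (y + σ y) * α = -(ϖ ^ (s + 1 + d) * u) := mul_left_cancel₀ (pow_ne_zero i hϖ0) (by linear_combination h1)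
    calc ρ * ϖ ^ (s + 1) = ϖ ^ d * u * α⁻¹ * ϖ ^ (s + 1) := by rw [hρ]
      _ = -((y + σ y) * α) * α⁻¹ := by rw [h2']; ring
      _ = -(y + σ y) := by rw [neg_mul, mul_inv_cancel_right₀ hα0]
  have hσρ : σ ρ = (-1) ^ (s + 1) * ρ := by
    have h1 : σ (ρ * ϖ ^ (s + 1)) = ρ * ϖ ^ (s + 1) := by rw [hρg, map_neg, map_add, hσσy]; ring
    rw [map_mul, hσpow] at h1
    have h3 : (σ ρ - (-1) ^ (s + 1) * ρ) * ϖ ^ (s + 1) = 0 := by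
      linear_combination (-1) ^ (s + 1) * h1 - (σ ρ * ϖ ^ (s + 1)) * hsq (s + 1)
    have h4 := (mul_eq_zero.1 h3).resolve_right (pow_ne_zero _ hϖ0)
    linear_combination h4
  set t : F := ρ * 2⁻¹ with ht; clear_value t
  have htO : t ∈ 𝒪[F] := by rw [ht]; exact (𝒪[F]).mul_mem hρO h2invO
  have hσt : σ t = (-1) ^ (s + 1) * ρ * 2⁻¹ := (by rw [ht, map_mul, hσρ, hσ2]); have h22 : (2 : F)⁻¹ + 2⁻¹ = 1 := by rw [← two_mul, mul_inv_cancel₀ h20]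
  set y₁ : F := y + ϖ ^ (s + 1) * t with hy₁; clear_value y₁
  have hy₁O : y₁ ∈ 𝒪[F] := by rw [hy₁]; exact (𝒪[F]).add_mem hy ((𝒪[F]).mul_mem (hϖpow _) htO)
  have hσy₁ : σ y₁ = -y₁ := by
    have h : y₁ + σ y₁ = 0 := by
      rw [hy₁, map_add, map_mul, hσpow, hσt, ht]
      linear_combination hρg + (ϖ ^ (s + 1) * ρ * 2⁻¹) * hsq (s + 1) + (ϖ ^ (s + 1) * ρ) * h22
    linear_combination h
  have hcinvO : c⁻¹ ∈ 𝒪[F] := inv_mem_of_valuation_eq_one hc1; have hainvO : a⁻¹ ∈ 𝒪[F] := inv_mem_of_valuation_eq_one ha1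
  set r : F := α * c⁻¹ with hr; clear_value r
  have hr' : r * c = α := (by rw [hr, inv_mul_cancel_right₀ hc0]); have hrO : r ∈ 𝒪[F] := by rw [hr]; exact (𝒪[F]).mul_mem hαO hcinvO
  have hr1 : valuation F r = 1 := by rw [hr, map_mul, map_inv₀, hα1, hc1]; simp
  have hσr_eq : σ r = -((-1) ^ i * (α * a⁻¹)) := by
    rw [hr, map_mul, map_inv₀, hσα, hσc]; field_simp
  have hres_r : valuation F (σ r - r) < 1 := by
    have hm : σO ⟨r, hrO⟩ - ⟨r, hrO⟩ ∈ IsLocalRing.maximalIdeal 𝒪[F] := hres ⟨r, hrO⟩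
    rw [IsLocalRing.mem_maximalIdeal, mem_nonunits_iff, (Valuation.integer.integers (valuation F)).isUnit_iff_valuation_eq_one] at hm
    have hle : valuation F (σ r - r) ≤ 1 := (Valuation.mem_integer_iff _ _).1 ((𝒪[F]).sub_mem (hσmem hrO) hrO)
    have hval : (algebraMap 𝒪[F] F) (σO ⟨r, hrO⟩ - ⟨r, hrO⟩) = σ r - r := by
      show ((σO ⟨r, hrO⟩ - ⟨r, hrO⟩ : 𝒪[F]) : F) = σ r - r
      rw [show ((σO ⟨r, hrO⟩ - ⟨r, hrO⟩ : 𝒪[F]) : F) = ((σO ⟨r, hrO⟩ : 𝒪[F]) : F) - r from rfl, hσO]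
    rw [hval] at hm
    exact lt_of_le_of_ne hle hm
  have hodd : Odd i := by
    rcases Nat.even_or_odd i with hev | hodd
    · exfalso
      have hdiff : σ r - r = -(α * (a + c) * (a * c)⁻¹) := by
        rw [hσr_eq, hr, hev.neg_one_pow]; field_simp; ring
      have hsum : valuation F (a + c) = 1 := by
        have hlt : valuation F (ϖ ^ (i + s + 1 + d) * u) < valuation F (2 * c) := by
          rw [map_mul, map_mul, map_pow, h21, hc1, one_mul, hu1, mul_one]
          exact pow_lt_one₀ zero_le hϖ.valuation_lt_one (by omega)
        rw [show a + c = 2 * c + ϖ ^ (i + s + 1 + d) * u by rw [← hac']; ring, Valuation.map_add_eq_of_lt_left _ hlt, map_mul, h21, hc1, one_mul]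
      have h1 : valuation F (σ r - r) = 1 := by
        rw [hdiff, Valuation.map_neg, map_mul, map_inv₀, map_mul, map_mul, hα1, hsum, ha1, hc1]; simp
      exact absurd h1 hres_r.ne
    · exact hodd
  have hm1i : (-1 : F) ^ i = -1 := hodd.neg_one_pow
  have hσr_sub : σ r - r = ϖ ^ (i + s + 1 + d) * -(α * u * (a * c)⁻¹) := by
    rw [hσr_eq, hm1i, hr]
    calc -((-1) * (α * a⁻¹)) - α * c⁻¹ = α * (a⁻¹ - c⁻¹) := by ring
      _ = α * ((c - a) / (a * c)) := by rw [inv_sub_inv ha0 hc0]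
      _ = ϖ ^ (i + s + 1 + d) * -(α * u * (a * c)⁻¹) := by
          rw [show c - a = -(ϖ ^ (i + s + 1 + d) * u) by rw [← hac']; ring, div_eq_mul_inv]; ring
  set w : F := -(α * u * (a * c)⁻¹) * 2⁻¹ with hw; clear_value w
  have hwO : w ∈ 𝒪[F] := by
    rw [hw, mul_inv]
    exact (𝒪[F]).mul_mem ((𝒪[F]).neg_mem ((𝒪[F]).mul_mem ((𝒪[F]).mul_mem hαO huO) ((𝒪[F]).mul_mem hainvO hcinvO))) h2invO
  set rt : F := (r + σ r) * 2⁻¹ with hrt; clear_value rt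
  have hrtw : rt = r + ϖ ^ (i + s + 1 + d) * w := by
    rw [hrt, hw, show r + σ r = 2 * r + (σ r - r) by ring, hσr_sub]; field_simp
  have hrtO : rt ∈ 𝒪[F] := by rw [hrtw]; exact (𝒪[F]).add_mem hrO ((𝒪[F]).mul_mem (hϖpow _) hwO)
  have hσrt : σ rt = rt := by rw [hrt, map_mul, map_add, hσσ' hrO, hσ2]; ring
  have hN0 : i + s + 1 + d ≠ 0 := by omega
  have hrt1 : valuation F rt = 1 := by
    have hlt : valuation F (ϖ ^ (i + s + 1 + d) * w) < valuation F r := by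
      rw [hr1, map_mul, map_pow]
      calc valuation F ϖ ^ (i + s + 1 + d) * valuation F w ≤ valuation F ϖ ^ (i + s + 1 + d) * 1 :=
            mul_le_mul_right ((Valuation.mem_integer_iff _ _).1 hwO) _
        _ < 1 := by rw [mul_one]; exact pow_lt_one₀ zero_le hϖ.valuation_lt_one hN0
    rw [hrtw, Valuation.map_add_eq_of_lt_left _ hlt, hr1]
  have hrt0 : rt ≠ 0 := ne_zero_of_valuation_eq_one hrt1; have hrtinvO : rt⁻¹ ∈ 𝒪[F] := inv_mem_of_valuation_eq_one hrt1
  set rtO : 𝒪[F] := ⟨rt, hrtO⟩ with hrtO'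
  have hrtU : IsUnit rtO := (Valuation.integer.integers (valuation F)).isUnit_iff_valuation_eq_one.2 hrt1
  have hσrtO : σO rtO = rtO := Subtype.ext (by rw [hσO]; exact hσrt)
  obtain ⟨lam, e, he1, hlamO', hlamE⟩ : ∃ lam : F, ∃ e : ℕ, e ≤ 1 ∧ lam ∈ 𝒪[F] ∧ ((η : 𝒪[F]) : F) ^ e * (lam * σ lam) = rt := by
    obtain ⟨sO, hsO⟩ := LocalFields.RamifiedQuadraticNorm.exists_mul_map_eq_or_eq_mul σO hσσ hres h2 hση hη hrtU hσrtO
    rcases hsO with h | h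
    · refine ⟨(sO : F), 0, zero_le_one, sO.2, ?_⟩; have h' := congrArg Subtype.val h; simpa [hσO] using h'
    · refine ⟨(sO : F), 1, le_rfl, sO.2, ?_⟩; have h' := congrArg Subtype.val h; simpa [hσO] using h'
  set ηe : F := ((η : 𝒪[F]) : F) ^ e with hηe
  have hηe1 : valuation F ηe = 1 := (by rw [hηe, map_pow, hη1, one_pow]); have hηe0 : ηe ≠ 0 := ne_zero_of_valuation_eq_one hηe1
  have hηeO : ηe ∈ 𝒪[F] := mem_of_valuation_eq_one hηe1
  have hlamE' : lam * σ lam = rt * ηe⁻¹ := by rw [← hlamE]; field_simp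
  have hσlamO : σ lam ∈ 𝒪[F] := hσmem hlamO'
  have hls1 : valuation F (lam * σ lam) = 1 := by rw [hlamE', map_mul, map_inv₀, hrt1, hηe1]; simp
  have hlam1 : valuation F lam = 1 := valuation_eq_one_of_mul_eq_one_left hlamO' hσlamO hls1
  have hσlam1 : valuation F (σ lam) = 1 := valuation_eq_one_of_mul_eq_one_left hσlamO hlamO' (by rw [mul_comm]; exact hls1)
  have hlam0 : lam ≠ 0 := ne_zero_of_valuation_eq_one hlam1; have hσlam0 : σ lam ≠ 0 := ne_zero_of_valuation_eq_one hσlam1; have hσσlam := hσσ' hlamO'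
  refine ⟨hodd, !![y₁ * lam, (σ lam)⁻¹; lam, 0], ?_, ?_, e, he1, ?_⟩
  · refine Fin.forall_fin_two.2 ⟨Fin.forall_fin_two.2 ⟨?_, ?_⟩, Fin.forall_fin_two.2 ⟨?_, ?_⟩⟩
    · simpa using (𝒪[F]).mul_mem hy₁O hlamO'
    · simpa using inv_mem_of_valuation_eq_one hσlam1
    · simpa using hlamO'
    · simp
  · rw [conjTranspose_fin_two, map_mul, map_inv₀, hσσlam, map_zero, hσy₁, Matrix.mul_fin_two, Matrix.mul_fin_two]
    refine fin_two_eq ?_ ?_ ?_ ?_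
    · ring
    · rw [show -y₁ * σ lam * 0 + σ lam * 1 = σ lam by ring, mul_inv_cancel₀ hσlam0]; ring
    · rw [show lam⁻¹ * 1 + 0 * 0 = lam⁻¹ by ring, inv_mul_cancel₀ hlam0]; ring
    · ring
  · set r01 : F := (p * (lam * σ lam)⁻¹ - c * ϖ ^ i * ηe) * (ϖ ^ (i + s + 1))⁻¹ with hr01; clear_value r01
    have hαrt : α - c * rt = -(c * ϖ ^ (i + s + 1 + d) * w) := by rw [hrtw, ← hr']; ring
    have hr01' : r01 = -(ϖ ^ (i + d) * (ηe * c * w * rt⁻¹)) := by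
      have h1 : r01 = ϖ ^ i * ηe * (α - c * rt) * rt⁻¹ * (ϖ ^ (i + s + 1))⁻¹ := by
        rw [hr01, hlamE', hpα]; field_simp
      rw [h1, hαrt]; field_simp; ring
    have e00 : lam⁻¹ * p * (y₁ * lam) + lam⁻¹ * (c - p * y) * lam = c + ϖ ^ (i + s + 1) * (α * t) := by
      rw [hy₁, hpα]; field_simp; ring
    have e01 : lam⁻¹ * p * (σ lam)⁻¹ = c * ϖ ^ i * ηe + ϖ ^ (i + s + 1) * r01 := by
      rw [hr01]; field_simp; ring
    have e10 : (σ lam * (a + p * y) + -y₁ * σ lam * p) * (y₁ * lam) + (σ lam * (-((a - c) * y) - p * y ^ 2) + -y₁ * σ lam * (c - p * y)) * lam =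
        ϖ ^ (i + s + 1) * (lam * σ lam * (ϖ ^ (s + 1 + d) * t * u - ϖ ^ (s + 1) * t ^ 2 * α)) := by
      rw [hy₁, hpα]; linear_combination (lam * σ lam * ϖ ^ (s + 1) * t) * hac'
    have e11 : (σ lam * (a + p * y) + -y₁ * σ lam * p) * (σ lam)⁻¹ = c + ϖ ^ (i + s + 1) * (ϖ ^ d * u - α * t) := by
      have h1 : (σ lam * (a + p * y) + -y₁ * σ lam * p) * (σ lam)⁻¹ = a + p * y - y₁ * p := by field_simp; ring
      rw [h1, hy₁, hpα]; linear_combination hac'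
    refine ⟨!![α * t, r01; lam * σ lam * (ϖ ^ (s + 1 + d) * t * u - ϖ ^ (s + 1) * t ^ 2 * α), ϖ ^ d * u - α * t], ?_, ?_⟩
    · refine Fin.forall_fin_two.2 ⟨Fin.forall_fin_two.2 ⟨?_, ?_⟩, Fin.forall_fin_two.2 ⟨?_, ?_⟩⟩
      · simpa using (𝒪[F]).mul_mem hαO htO
      · have : r01 ∈ 𝒪[F] := by
          rw [hr01']
          exact (𝒪[F]).neg_mem ((𝒪[F]).mul_mem (hϖpow _)
            ((𝒪[F]).mul_mem ((𝒪[F]).mul_mem ((𝒪[F]).mul_mem hηeO hcO) hwO) hrtinvO))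
        simpa using this
      · simpa using (𝒪[F]).mul_mem ((𝒪[F]).mul_mem hlamO' hσlamO) ((𝒪[F]).sub_mem ((𝒪[F]).mul_mem ((𝒪[F]).mul_mem (hϖpow _) htO) huO)
          ((𝒪[F]).mul_mem ((𝒪[F]).mul_mem (hϖpow _) ((𝒪[F]).pow_mem htO 2)) hαO))
      · simpa using (𝒪[F]).sub_mem ((𝒪[F]).mul_mem (hϖpow _) huO) ((𝒪[F]).mul_mem hαO htO)
    · rw [hkmat, conjTranspose_fin_two, map_mul, map_inv₀, hσσlam, map_zero, hσy₁, Matrix.mul_fin_two, Matrix.mul_fin_two,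
        Matrix.mul_fin_two, Matrix.mul_fin_two, ← hηe, normalForm_add_eq]
      refine fin_two_eq ?_ ?_ ?_ ?_
      · linear_combination e00
      · linear_combination e01
      · linear_combination e10
      · linear_combination e11

end Core

end Literature.NumberTheory.Automorphic

end
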